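import Mathlib
import HarnessLib
import HarnessLib.Audit.Tags
import Summits.HodgeConjecture.HodgeConjecture.Theorems.HodgeLocusCensusPointCountAnchors

/-!
# HodgeLocusCensusPointCountAnchors13 — the sextic quotient model at `p = 13`, kernel-counted (cell pub-hlocus, abs-1 gen 12)
HONEST FRAMING: certified instances and evidence bearing on the general Hodge conjecture; no claim.

Continuation of `HodgeLocusCensusPointCountAnchors` (same definition `sexticConeCount`): the affine-cone count of the
quotient model `S_s : U³ = Y₀Y₁Y₂, m² = U(m − sY₀ − Y₁ − Y₂)` of the Fermat-sextic double-plane pencil (`G = C₂ × C₆`) at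
`p = 13`, every parameter, `= 13³ + 12·h` with `h` the literal integer engine A-FF tabulates as `H_13(t)`, `t = 1728 s`
(`h = 1` at `t = 0`).  WHY `p = 13`: in the χ-closure argument recorded by engine A-PC (`data/abs/pc/CHI-ARGUMENT.md`:
granted that the rank-3 invariant local system `W` and the hypergeometric sheaf `M` are geometrically isomorphic, the
comparison character `χ_ℓ` is a character of `Gal(ℚ̄/ℚ)` of order dividing 6, unramified outside `{2, 3, ℓ}`; for `ℓ = 17`
every such character trivial on `Frob_5, Frob_7, Frob_11, Frob_13` is trivial — `(ℤ/1224)^×` is generated by `5, 7, 11, 13`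
and sixth powers), the deciding places are the primes `5, 7, 11, 13`; the earlier file decides the count side there for the
quartic and for the sextic at `5, 7, 11`; this file adds the sextic at `13`.  That `h` is the BCM value, and the structural
inputs of that argument, are NOT checked here; nothing here is a statement about the Hodge conjecture.
-/
namespace Summit.HodgeConjecture.HodgeConjecture.HodgeLocus.Census

/-- `1728⁻¹ ≡ 12 (mod 13)`: the parameter `s` of the model at the table's `t` is `s = 12 t`. -/
theorem sextic_dictionary13 : 1728 * 12 % 13 = 1 := by decide

/-- The sixth powers of the units of `ℤ/1224` (`1224 = 8·9·17`), as residues. -/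
def sixthPowers1224 : List ℕ := [1, 145, 217, 361, 433, 577, 865, 937]

/-- Every listed residue is the sixth power of some residue mod `1224`. -/
theorem sixthPowers1224_spec : ∀ y ∈ sixthPowers1224, ∃ x < 1224, x ^ 6 % 1224 = y := by decide +kernel

set_option maxHeartbeats 400000000 in
set_option maxRecDepth 100000 in
/-- The group-theoretic half of the finite check: every unit `u` of `ℤ/1224` lies in the subgroup generated by `5, 7, 11, 13`
and the sixth powers (so a character of `(ℤ/1224)^×` of order dividing 6 that is trivial on `5, 7, 11, 13` is trivial).
Witnessed as: some `u·5^a·7^b·11^c·13^d` is a sixth power. -/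
theorem units1224_generated :
    ∀ u < 1224, Nat.Coprime u 1224 → ∃ a < 2, ∃ b < 6, ∃ c < 2, ∃ d < 2,
      (u * 5 ^ a * 7 ^ b * 11 ^ c * 13 ^ d) % 1224 ∈ sixthPowers1224 := by
  decide +kernel

set_option maxHeartbeats 400000000 in
set_option maxRecDepth 100000 in
/-- `B_13(s) = 13³ + 12·h` with `s = t/1728`, listed by `t = 0,…,12`. -/
theorem sexticCone_p13 :
    (List.range 13).map (fun t => sexticConeCount 13 (12 * t % 13))
      = [(1 : ℤ), 10, -9, 9, 12, -13, 12, 9, 4, -3, -12, 3, -23].map (fun h => (2197 + 12 * h).toNat) := by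
  decide +kernel


end Summit.HodgeConjecture.HodgeConjecture.HodgeLocus.Census
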